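import Summits.BirchSwinnertonDyer.BirchSwinnertonDyer.Theorems.UniversalToricDescentThinCombDescentControlSemilinear
import Summits.BirchSwinnertonDyer.BirchSwinnertonDyer.Theorems.PrintCf2SplitBadTwoTwoVarSpecializationFiniteJunk
import Summits.BirchSwinnertonDyer.BirchSwinnertonDyer.Theorems.PrintCf2RubinValueTwoNoPseudoNullTwistTransport
import Literature.NumberTheory.EllipticCurves.IwasawaAlgebraSemilinearCharIdealProofs
import HarnessLib

/-!
# Specialisation of `ch_{Λ₂}(X_Gr(E/K̃_∞))` along the anticyclotomic line `𝔞_k = ((1+T₂) − (1+T₁)^e)` of a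
# 𝔭-adapted frame: `(φ_e g) ⊆ ch_Λ(X_ac(κ, γ))` under S3n′
# (line `thin_comb` v3 on the WALL `AdditiveSplitIMCInclusionAtThree`, stmt-BirchSwinnertonDyer-20395; helper for
# `stub_descent`, `--supports`; cell `pub/bsd-wall`, lead `cruxlead-20395` g3)

THE GLUE of `stub_descent` (v3) at the `ℤ_p` level. Inputs: a generator pair `(κ₁, κ₂; γ₁, γ₂)`, a `ℤ_p`-line `κ`
through the tower with generator `γ` and the frame relations `γ₁γ⁻¹ ∈ ker κ`, `γ₂(γ^e)⁻¹ ∈ ker κ`; `E(K)[p] = 0`;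
`X₂ = X_Gr(E/K̃_∞)` (`XGr₂ W p κ₁ κ₂ v̄ γ₁ γ₂`) finitely generated and torsion with `ch_{Λ₂}(X₂) = (g)` and every
pseudo-null `Λ₂`-submodule FINITE (S3n′). Output (`span_spec_le_charIdeal`):
**`(φ_e g) ⊆ ch_Λ(X_ac^∅(κ, γ))`**, `φ_e : T₁ ↦ T, 1 + T₂ ↦ (1+T)^e` (`TwoVarSubst.spec e`).

Proof. Twist `X₂` by the shear automorphism `α_e` of `Λ₂` (`…DescentShear.lean`; `α_e T₁ = T₂ − ((1+T₁)^e − 1)` generates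
`ker φ_e`, `φ_e ∘ α_e = constantCoeff`): the twisted module `X₂^{α}` (type synonym `Twist`, `r ⋆ m = α_e(r) • m`) is
finitely generated, torsion, S3n′, with `ch(X₂^{α}) = (α_e⁻¹ g)` (tree `Module.charIdeal_eq_map_of_semilinearEquiv`,
`PrintCf2.SpecializationNoPseudoNull.isPseudoNull_of_semilinear_addEquiv`), and the `φ_e`-semilinear dual control map
`Ψ` (`…DescentControlSemilinear.lean`) is `constantCoeff`-semilinear on `X₂^{α}`, so it induces a SURJECTIVE `Λ`-linear
`X₂^{α}/T₁ ↠ X_ac(κ, γ)`. Then the tree's `T₁ ↦ 0` chain (`PrintCf2.TwoVarSpecializationFinite.map_constantCoeff_charIdeal_eq_of_pseudoNull_finite`,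
`LocalLength.charIdeal_le_of_lengthAt_ne_zero`, multiplicativity `Module.charIdeal_eq_mul_of_exact`) gives
`(constantCoeff (α_e⁻¹ g)) ⊆ ch_Λ(X_ac)`, and `constantCoeff ∘ α_e⁻¹ = φ_e`.

Theorems + one type synonym with its instances (plumbing); no named fact, no `sorry`; nothing about BSD is claimed.
References: [SkinnerUrban2014] §3.1.6, Prop. 3.2.8, Cor. 3.2.9; [Greenberg2016] Prop. 4.1.1; [Delbourgo2008] Lemma 10.5.
-/

set_option linter.dupNamespace false
set_option autoImplicit false

noncomputable section

open scoped Classical Pointwise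

open NumberField IsDedekindDomain Field Function
open Literature.NumberTheory.GaloisRepresentations Literature.NumberTheory.EllipticCurves
open Literature.NumberTheory.EllipticCurves.Module
open Literature.NumberTheory.EllipticCurves.Castella2018 Literature.NumberTheory.EllipticCurves.TwoVariableSelmer
open Summit.BirchSwinnertonDyer.BirchSwinnertonDyer.Theorems.SignedBaseChangeAcDivSpecialization
open Summit.BirchSwinnertonDyer.BirchSwinnertonDyer.Theorems.SignedBaseChangeAcDivSpecialization.LocalLength
open Summit.BirchSwinnertonDyer.BirchSwinnertonDyer.Theorems.SignedBaseChangeAcDivSpecialization.PowerSeriesSpecialization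
open Summit.BirchSwinnertonDyer.BirchSwinnertonDyer.Theorems.PrintCf2

universe u

namespace Summit.BirchSwinnertonDyer.BirchSwinnertonDyer.Theorems.UniversalToricDescentThinComb.DescentSpecialise

/-! ## §1 The twist of a module by a ring endomorphism -/

section Twist

variable {Λ' : Type*} [CommRing Λ'] (α : Λ' →+* Λ') (X : Type*) [AddCommGroup X] [Module Λ' X]

/-- **`Twist α X`**: the abelian group `X` with scalars restricted along `α` (`r ⋆ m = α(r) • m`). A type synonym. -/
@[nolint unusedArguments]
def Twist (_α : Λ' →+* Λ') (X : Type*) [AddCommGroup X] [Module Λ' X] : Type _ := X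

/-- The additive group structure of the twist is that of `X`. -/
instance instAddCommGroupTwist : AddCommGroup (Twist α X) := inferInstanceAs (AddCommGroup X)

/-- The twisted module structure `r ⋆ m = α(r) • m` (`Module.compHom`). -/
instance instModuleTwist : Module Λ' (Twist α X) := Module.compHom X α

/-- The identity `Twist α X ≃+ X`. -/
def Twist.toOrig : Twist α X ≃+ X := AddEquiv.refl X

/-- Semilinearity of the identity: `toOrig (r ⋆ m) = α r • toOrig m` (definitional). -/
theorem Twist.toOrig_smul (r : Λ') (m : Twist α X) :
    Twist.toOrig α X (r • m) = α r • Twist.toOrig α X m := rfl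

variable {α X}

/-- The twist by a ring AUTOMORPHISM of a finitely generated module is finitely generated. [folklore] -/
theorem Twist.moduleFinite (σ : Λ' ≃+* Λ') [Module.Finite Λ' X] :
    Module.Finite Λ' (Twist (σ : Λ' →+* Λ') X) := by
  haveI : RingHomSurjective ((σ.symm : Λ' ≃+* Λ') : Λ' →+* Λ') := ⟨σ.symm.surjective⟩
  let f : X →ₛₗ[((σ.symm : Λ' ≃+* Λ') : Λ' →+* Λ')] Twist (σ : Λ' →+* Λ') X :=
    { toFun := (Twist.toOrig (σ : Λ' →+* Λ') X).symm
      map_add' := fun _ _ => rfl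
      map_smul' := fun r x => by
        change r • x = (σ : Λ' →+* Λ') (σ.symm r) • x
        rw [RingEquiv.coe_toRingHom, RingEquiv.apply_symm_apply] }
  exact (LinearMap.finite_iff_of_bijective f (AddEquiv.bijective _)).mp ‹_›

/-- The twist by a ring automorphism of a torsion module over a domain is torsion. [folklore] -/
theorem Twist.isTorsion [IsDomain Λ'] (σ : Λ' ≃+* Λ') (hX : Module.IsTorsion Λ' X) :
    Module.IsTorsion Λ' (Twist (σ : Λ' →+* Λ') X) := by
  intro m
  obtain ⟨⟨r, hr⟩, hrm⟩ := @hX (Twist.toOrig (σ : Λ' →+* Λ') X m)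
  refine ⟨⟨σ.symm r, ?_⟩, ?_⟩
  · exact mem_nonZeroDivisors_of_ne_zero fun h =>
      nonZeroDivisors.ne_zero hr (by simpa using congrArg σ h)
  · change (σ : Λ' →+* Λ') (σ.symm r) • (Twist.toOrig (σ : Λ' →+* Λ') X m) = 0
    rw [RingEquiv.coe_toRingHom, RingEquiv.apply_symm_apply]
    exact hrm

/-- **S3n′ passes to the twist**: if every pseudo-null submodule of `X` is finite, so is every pseudo-null submodule
of `Twist σ X` (its carrier is a submodule of `X`, pseudo-null by transport along `σ`). [folklore] -/
theorem Twist.pseudoNull_finite (σ : Λ' ≃+* Λ')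
    (hfin : ∀ N : Submodule Λ' X, Module.IsPseudoNull Λ' N → Finite N) :
    ∀ N' : Submodule Λ' (Twist (σ : Λ' →+* Λ') X), Module.IsPseudoNull Λ' N' → Finite N' := by
  intro N' hN'
  -- the same carrier as a submodule of `X`
  let N : Submodule Λ' X :=
    { carrier := {x | (Twist.toOrig (σ : Λ' →+* Λ') X).symm x ∈ N'}
      add_mem' := fun {a b} ha hb => N'.add_mem ha hb
      zero_mem' := N'.zero_mem
      smul_mem' := fun r x hx => by
        have := N'.smul_mem (σ.symm r) hx
        change (σ : Λ' →+* Λ') (σ.symm r) • x ∈ N' at this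
        rwa [RingEquiv.coe_toRingHom, RingEquiv.apply_symm_apply] at this }
  -- `N' ≃+ N`, `σ`-semilinear
  let e : N' ≃+ N :=
    { toFun := fun n => ⟨Twist.toOrig (σ : Λ' →+* Λ') X n, n.2⟩
      invFun := fun n => ⟨(Twist.toOrig (σ : Λ' →+* Λ') X).symm n, n.2⟩
      left_inv := fun _ => rfl
      right_inv := fun _ => rfl
      map_add' := fun _ _ => rfl }
  have he : ∀ (r : Λ') (n : N'), e (r • n) = σ r • e n := fun _ _ => rfl
  have hN : Module.IsPseudoNull Λ' N :=
    SpecializationNoPseudoNull.isPseudoNull_of_semilinear_addEquiv σ e he hN'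
  haveI : Finite N := hfin N hN
  exact Finite.of_equiv N e.symm

/-- **`ch(Twist σ X) = σ⁻¹(ch X)`** (tree `Module.charIdeal_eq_map_of_semilinearEquiv`). [cite: BourbakiAC5to7, Ch. VII §4.5] -/
theorem Twist.charIdeal_eq (σ : Λ' ≃+* Λ') :
    charIdeal Λ' (Twist (σ : Λ' →+* Λ') X) = (charIdeal Λ' X).map (σ.symm : Λ' →+* Λ') := by
  have h := charIdeal_eq_map_of_semilinearEquiv σ (Twist.toOrig (σ : Λ' →+* Λ') X) (fun r m => rfl)
  -- `h : charIdeal X = (charIdeal (Twist σ X)).map σ`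
  rw [h, Ideal.map_map]
  have : ((σ.symm : Λ' ≃+* Λ') : Λ' →+* Λ').comp (σ : Λ' →+* Λ') = RingHom.id Λ' :=
    RingHom.ext fun r => σ.symm_apply_apply r
  rw [this, Ideal.map_id]

/-- `ch(Twist σ X) = (σ⁻¹ g)` when `ch(X) = (g)`. [cite: BourbakiAC5to7, Ch. VII §4.5] -/
theorem Twist.charIdeal_eq_span (σ : Λ' ≃+* Λ') {g : Λ'} (hg : charIdeal Λ' X = Ideal.span {g}) :
    charIdeal Λ' (Twist (σ : Λ' →+* Λ') X) = Ideal.span {σ.symm g} := by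
  rw [Twist.charIdeal_eq, hg, Ideal.map_span, Set.image_singleton]
  rfl

end Twist

/-! ## §2 The specialisation along `𝔞_e` -/

variable {K : Type u} [Field K] [NumberField K] (W : WeierstrassCurve K) (p : ℕ) [Fact p.Prime]
  (κ₁ κ₂ κ : ZpExtension K p) (vbar : HeightOneSpectrum (𝓞 K))
  (γ₁ γ₂ γ : absoluteGaloisGroup K)
  [hpair : Fact (ZpExtension.IsTopGeneratorPair κ₁ κ₂ γ₁ γ₂)] [hγ : Fact (κ.IsTopGenerator γ)]

/-- **THE SPECIALISATION** (`ℤ_p` level). Under `E(K)[p] = 0`, the frame relations, finite generation, torsion and S3n′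
for `X₂ = X_Gr(E/K̃_∞)` with `ch_{Λ₂}(X₂) = (g)`: `(φ_e g) ⊆ ch_Λ(X_ac^∅(κ, γ))`.
[cite: SkinnerUrban2014, Prop. 3.2.8 and Cor. 3.2.9 (pp. 23–24)] [cite: Greenberg2016, Prop. 4.1.1] [cite: Delbourgo2008, Ch. X Lemma 10.5] -/
theorem span_spec_le_charIdeal [W.IsElliptic] (hker : ZpExtension.pairKer κ₁ κ₂ ≤ κ.kerSubgroup)
    {e : ℕ} (hγ₁ : γ₁ * γ⁻¹ ∈ κ.kerSubgroup)
    (hγ₂ : γ₂ * (γ ^ e)⁻¹ ∈ κ.kerSubgroup) (hK : ∀ P : W.toAffine.Point, p • P = 0 → P = 0)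
    [Module.Finite (IwasawaAlgebra₂ p) (W.XGr₂ p κ₁ κ₂ vbar γ₁ γ₂)]
    (htors : Module.IsTorsion (IwasawaAlgebra₂ p) (W.XGr₂ p κ₁ κ₂ vbar γ₁ γ₂))
    (hfin : ∀ N : Submodule (IwasawaAlgebra₂ p) (W.XGr₂ p κ₁ κ₂ vbar γ₁ γ₂),
      Module.IsPseudoNull (IwasawaAlgebra₂ p) N → Finite N)
    {g : IwasawaAlgebra₂ p} (hg : charIdeal (IwasawaAlgebra₂ p) (W.XGr₂ p κ₁ κ₂ vbar γ₁ γ₂) = Ideal.span {g}) :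
    Ideal.span {TwoVarSubst.spec e g} ≤ AcSelmer.XAc.charIdeal W p κ vbar ∅ γ := by
  -- notation
  set X₂ := W.XGr₂ p κ₁ κ₂ vbar γ₁ γ₂ with hX₂
  let σ : IwasawaAlgebra₂ p ≃+* IwasawaAlgebra₂ p := TwoVarSubst.alphaEquiv (R := ℤ_[p]) e
  let M := Twist (σ : IwasawaAlgebra₂ p →+* IwasawaAlgebra₂ p) X₂
  haveI : Module.Finite (IwasawaAlgebra₂ p) M := Twist.moduleFinite σ
  haveI : UniqueFactorizationMonoid (IwasawaAlgebra₂ p) :=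
    Literature.NumberTheory.IwasawaTheory.uniqueFactorizationMonoid_iwasawaAlgebraTwoVar p
  have htorsM : Module.IsTorsion (IwasawaAlgebra₂ p) M := Twist.isTorsion σ htors
  have hfinM : ∀ N : Submodule (IwasawaAlgebra₂ p) M, Module.IsPseudoNull (IwasawaAlgebra₂ p) N → Finite N :=
    Twist.pseudoNull_finite σ hfin
  have hcharM : charIdeal (IwasawaAlgebra₂ p) M = Ideal.span {σ.symm g} := Twist.charIdeal_eq_span σ hg
  have hspec : TwoVarSubst.spec e g = PowerSeries.constantCoeff (σ.symm g) :=
    TwoVarSubst.spec_eq_constantCoeff_symm e g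
  -- the dual control map on the twist is `constantCoeff`-semilinear
  let Ψ : M →ₛₗ[(PowerSeries.constantCoeff : IwasawaAlgebra₂ p →+* IwasawaAlgebra p)] AcSelmer.XAc W p κ vbar ∅ γ :=
    { toFun := fun m => DescentControl.resDual W p κ₁ κ₂ κ vbar hker γ₁ γ₂ γ (Twist.toOrig _ X₂ m)
      map_add' := fun a b => map_add _ _ _
      map_smul' := fun r m => by
        change DescentControl.resDual W p κ₁ κ₂ κ vbar hker γ₁ γ₂ γ (TwoVarSubst.alpha e r • Twist.toOrig _ X₂ m) = _
        rw [DescentControl.resDual_smul W p κ₁ κ₂ κ vbar hker γ₁ γ₂ γ hγ₁ hγ₂, TwoVarSubst.spec_alpha] }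
  have hΨsurj : Function.Surjective Ψ :=
    DescentControl.resDual_surjective W p κ₁ κ₂ κ vbar hker γ₁ γ₂ γ hK
  -- it kills `T₁ • M` and descends to a `Λ`-linear surjection `M/T₁M ↠ X_ac`
  have hkerΨ : (PowerSeries.X : IwasawaAlgebra₂ p) • (⊤ : Submodule (IwasawaAlgebra₂ p) M) ≤ LinearMap.ker Ψ := by
    rw [← Submodule.ideal_span_singleton_smul]
    refine Submodule.smul_le.mpr fun r hr x _ => ?_
    obtain ⟨a, rfl⟩ := Ideal.mem_span_singleton'.mp hr
    rw [LinearMap.mem_ker, mul_smul, LinearMap.map_smulₛₗ, LinearMap.map_smulₛₗ, PowerSeries.constantCoeff_X, zero_smul,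
      smul_zero]
  letI instQ : Module (IwasawaAlgebra p) (QuotSMulTop (PowerSeries.X : IwasawaAlgebra₂ p) M) :=
    Module.compHom _ (PowerSeries.C (R := IwasawaAlgebra p))
  let Ψq := ((PowerSeries.X : IwasawaAlgebra₂ p) • (⊤ : Submodule (IwasawaAlgebra₂ p) M)).liftQ Ψ hkerΨ
  let f : QuotSMulTop (PowerSeries.X : IwasawaAlgebra₂ p) M →ₗ[IwasawaAlgebra p] AcSelmer.XAc W p κ vbar ∅ γ :=
    { toFun := Ψq
      map_add' := Ψq.map_add
      map_smul' := fun a q => by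
        show Ψq ((PowerSeries.C a : IwasawaAlgebra₂ p) • q) = a • Ψq q
        rw [Ψq.map_smulₛₗ, PowerSeries.constantCoeff_C] }
  have hf : Function.Surjective f := fun y => by
    obtain ⟨m, rfl⟩ := hΨsurj y
    exact ⟨Submodule.Quotient.mk m, rfl⟩
  -- dichotomy on `(T₁) ∈ Supp M`
  have hXp : Prime (PowerSeries.X : IwasawaAlgebra₂ p) := PowerSeries.X_prime
  let 𝔮 : PrimeSpectrum (IwasawaAlgebra₂ p) :=
    ⟨Ideal.span {(PowerSeries.X : IwasawaAlgebra₂ p)}, (Ideal.span_singleton_prime hXp.ne_zero).mpr hXp⟩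
  by_cases h0 : lengthAt (IwasawaAlgebra₂ p) M 𝔮 = 0
  · obtain ⟨s, hs𝔮, hs⟩ := exists_notMem_forall_smul_eq_zero_of_lengthAt_eq_zero h0
    have hs' : ∃ s : IwasawaAlgebra₂ p, PowerSeries.constantCoeff s ≠ 0 ∧ ∀ m : M, s • m = 0 :=
      ⟨s, fun h => hs𝔮 ((mem_span_X_iff (A := IwasawaAlgebra p)).mpr h), hs⟩
    have hsp := TwoVarSpecializationFinite.map_constantCoeff_charIdeal_eq_of_pseudoNull_finite p M hs' hfinM
    -- `M/T₁M` is finitely generated torsion over `Λ` (constants structure)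
    let alg : Algebra (IwasawaAlgebra p) (IwasawaAlgebra₂ p) :=
      @MvPowerSeries.instAlgebra Unit (IwasawaAlgebra p) (IwasawaAlgebra p) _ _ (Algebra.id _)
    letI : Module (IwasawaAlgebra p) M := Module.compHom M (PowerSeries.C (R := IwasawaAlgebra p))
    have hIST : @IsScalarTower (IwasawaAlgebra p) (IwasawaAlgebra₂ p) M alg.toSMul inferInstance inferInstance :=
      @IsScalarTower.mk _ _ _ alg.toSMul _ _ fun a r m => by
        rw [@Algebra.smul_def _ _ _ _ alg a r, mul_smul]
        rfl
    obtain ⟨s, hs0, hsM⟩ := hs'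
    haveI : Module.Finite (IwasawaAlgebra p) (QuotSMulTop (PowerSeries.X : IwasawaAlgebra₂ p) M) :=
      @moduleFinite_quotSMulTop (IwasawaAlgebra p) _ M _ _ _ hIST _
    have h1 := (@isTorsionBy_constantCoeff (IwasawaAlgebra p) _ M _ _ _ hIST s hsM).1
    have htorsQ : Module.IsTorsion (IwasawaAlgebra p) (QuotSMulTop (PowerSeries.X : IwasawaAlgebra₂ p) M) := fun q =>
      ⟨⟨PowerSeries.constantCoeff s, mem_nonZeroDivisors_of_ne_zero hs0⟩, @h1 q⟩
    have hmul := charIdeal_eq_mul_of_exact htorsQ (LinearMap.ker f).subtype f (Submodule.subtype_injective _) hf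
      (LinearMap.exact_subtype_ker_map f)
    -- assemble
    have hle : (charIdeal (IwasawaAlgebra₂ p) M).map (PowerSeries.constantCoeff (R := IwasawaAlgebra p)) ≤
        charIdeal (IwasawaAlgebra p) (AcSelmer.XAc W p κ vbar ∅ γ) := by
      rw [hsp, hmul]
      exact Ideal.mul_le_left
    rw [hcharM, Ideal.map_span, Set.image_singleton] at hle
    rw [hspec]
    exact hle
  · -- `(T₁) ∈ Supp M`: then `T₁ ∣ σ⁻¹ g`, so `φ_e g = 0`
    have hle : charIdeal (IwasawaAlgebra₂ p) M ≤ 𝔮.asIdeal :=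
      charIdeal_le_of_lengthAt_ne_zero htorsM (height_span_X (A := IwasawaAlgebra p)) h0
    rw [hcharM, Ideal.span_singleton_le_iff_mem] at hle
    have hdvd : (PowerSeries.X : IwasawaAlgebra₂ p) ∣ σ.symm g := Ideal.mem_span_singleton.mp hle
    have hzero : TwoVarSubst.spec e g = 0 := by
      rw [hspec]
      exact PowerSeries.X_dvd_iff.mp hdvd
    rw [hzero, Ideal.span_singleton_eq_bot.mpr rfl]
    exact bot_le

end Summit.BirchSwinnertonDyer.BirchSwinnertonDyer.Theorems.UniversalToricDescentThinComb.DescentSpecialise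

end
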